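import Mathlib.MeasureTheory.Integral.RieszMarkovKakutani.Real
import Mathlib.MeasureTheory.Group.Integral
import Mathlib.MeasureTheory.Group.ModularCharacter
import Mathlib.MeasureTheory.Measure.Haar.Unique
import Literature.NumberTheory.Automorphic.HaarIntegralClosedCompact
import Literature.NumberTheory.Automorphic.ClosedCompactDecomposition
import HarnessLib

/-!
# Proof of Deitmar–Echterhoff Prop. 1.5.6: `∫_G f = c ∫_H ∫_K f(hk)` for `G = HK`

Topic `NumberTheory/Automorphic`; namespace `Literature.NumberTheory.Automorphic.HaarHK`. Proof of
the conclusion of the named fact `DeitmarEchterhoff2014_prop156` of `HaarIntegralClosedCompact` **for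
second countable `G`** (`integral_eq_mul_integral_integral_of_secondCountable`; the named fact is
stated, as printed, for every locally compact group, and the Baire-category and Riesz–Markov steps
below use second countability — the case of all groups of the tree's applications, `GL_n(F)`,
`GL_n(𝔸_K)` and their closed subgroups), following the printed proof (Deitmar–Echterhoff,
*Principles of Harmonic Analysis* (2014), Prop. 1.5.6 via the uniqueness half of Thm. 1.5.3): the
group `P = H × K` acts transitively on `G` by `(h, k) · g = h g k⁻¹` with compact stabiliser
`M = {(m, m) | m ∈ H ∩ K}`; the Haar measure `μ_G` is invariant under this action (left invariance,
and `Δ_G ≡ 1` on the compact `K`), and every `P`-invariant Radon measure on `G ≅ P/M` comes from a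
left Haar measure on `P`. Concretely, Mathlib having no homogeneous-space measure theory, we run the
uniqueness argument through functions:

1. `hkMap (h, k) = h k⁻¹` is an open (`isOpenMap_subgroup_mul`, Baire), proper, surjective quotient
   map `P → G` with fibres the right `M`-cosets (`diagSubgroup`).
2. For `φ ∈ C_c(P)` the **fibre average** `∫_M φ(p m) dm` (Haar probability of the compact group
   `M`) is continuous, compactly supported and right `M`-invariant, hence descends to
   `descend φ ∈ C_c(G)` with `descend φ ∘ hkMap = fibreAverage φ`.
3. `Λ(φ) = ∫_G descend φ dμ_G` is a positive linear functional on `C_c(P)`, invariant under left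
   translations of `P` (they become `g ↦ h₀ g k₀⁻¹` downstairs). By the Riesz–Markov–Kakutani
   theorem (Mathlib `RealRMK.rieszMeasure`) it is integration against a regular left-invariant
   measure `λ̃` on `P`, which by uniqueness of Haar measure is `c · μ_H ⊗ μ_K`.
4. For `f ∈ C_c(G)`, `φ = f ∘ hkMap ∈ C_c(P)` (properness) has `descend φ = f`, so
   `∫_G f dμ_G = Λ(φ) = c ∫_{H×K} f(h k⁻¹) = c ∫_H ∫_K f(hk)` (inversion invariance of `μ_K`).
   Hence `μ_G = c · (hkMap)_*(μ_H ⊗ μ_K)` as measures, and the formula for all `f ∈ L¹(G)` follows.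
-/

noncomputable section

open MeasureTheory Measure Set Filter Topology Function CompactlySupported
open scoped ENNReal Pointwise

namespace Literature.NumberTheory.Automorphic

namespace HaarHK

universe u

/-! ### The map `(h, k) ↦ h k⁻¹` and its fibres (algebra) -/

section Algebra

variable {G : Type u} [Group G] (H K : Subgroup G)

/-- The twisted multiplication `a(h, k) = h k⁻¹ : H × K → G`, the orbit map at `1` of the action
`(h, k) · g = h g k⁻¹`. [folklore] -/
def hkMap (p : ↥H × ↥K) : G := (p.1 : G) * ((p.2 : G))⁻¹

/-- The stabiliser `M = {(m, m)} ≤ H × K` of `1` (isomorphic to `H ∩ K`). [folklore] -/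
def diagSubgroup : Subgroup (↥H × ↥K) where
  carrier := {p | (p.1 : G) = (p.2 : G)}
  mul_mem' := by
    rintro ⟨h, k⟩ ⟨h', k'⟩ (hp : (h : G) = k) (hq : (h' : G) = k')
    show ((h * h' : ↥H) : G) = ((k * k' : ↥K) : G)
    rw [Subgroup.coe_mul, Subgroup.coe_mul, hp, hq]
  one_mem' := by
    show ((1 : ↥H) : G) = ((1 : ↥K) : G)
    rw [Subgroup.coe_one, Subgroup.coe_one]
  inv_mem' := by
    rintro ⟨h, k⟩ (hp : (h : G) = k)
    show ((h⁻¹ : ↥H) : G) = ((k⁻¹ : ↥K) : G)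
    rw [Subgroup.coe_inv, Subgroup.coe_inv, hp]

variable {H K}

/-- Membership in `M` (definitional). [folklore] -/
theorem mem_diagSubgroup_iff {p : ↥H × ↥K} : p ∈ diagSubgroup H K ↔ (p.1 : G) = (p.2 : G) :=
  Iff.rfl

/-- `hkMap` unfolded. [folklore] -/
theorem hkMap_apply (p : ↥H × ↥K) : hkMap H K p = (p.1 : G) * ((p.2 : G))⁻¹ := rfl

/-- **Equivariance**: `a((h₀, k₀) p) = h₀ a(p) k₀⁻¹`. [folklore] -/
theorem hkMap_mul (p₀ p : ↥H × ↥K) :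
    hkMap H K (p₀ * p) = (p₀.1 : G) * hkMap H K p * ((p₀.2 : G))⁻¹ := by
  simp only [hkMap_apply, Prod.fst_mul, Prod.snd_mul, Subgroup.coe_mul, mul_inv_rev, mul_assoc]

/-- **Fibres of `a` are the right `M`-cosets**: `a(p) = a(q) ↔ p⁻¹ q ∈ M`. [folklore] -/
theorem hkMap_eq_iff (p q : ↥H × ↥K) : hkMap H K p = hkMap H K q ↔ p⁻¹ * q ∈ diagSubgroup H K := by
  obtain ⟨h, k⟩ := p
  obtain ⟨h', k'⟩ := q
  rw [mem_diagSubgroup_iff]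
  simp only [hkMap_apply, Prod.inv_mk, Prod.mk_mul_mk, Subgroup.coe_mul, Subgroup.coe_inv]
  constructor
  · intro h1
    calc (h : G)⁻¹ * (h' : G) = (h : G)⁻¹ * ((h' : G) * ((k' : G))⁻¹) * (k' : G) := by group
      _ = (h : G)⁻¹ * ((h : G) * ((k : G))⁻¹) * (k' : G) := by rw [h1]
      _ = ((k : G))⁻¹ * (k' : G) := by group
  · intro h1
    calc (h : G) * ((k : G))⁻¹ = (h : G) * (((k : G))⁻¹ * (k' : G)) * ((k' : G))⁻¹ := by group
      _ = (h : G) * ((h : G)⁻¹ * (h' : G)) * ((k' : G))⁻¹ := by rw [h1]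
      _ = (h' : G) * ((k' : G))⁻¹ := by group

/-- `a(p m) = a(p)` for `m ∈ M`. [folklore] -/
theorem hkMap_mul_of_mem (p : ↥H × ↥K) {m : ↥H × ↥K} (hm : m ∈ diagSubgroup H K) :
    hkMap H K (p * m) = hkMap H K p := by
  refine ((hkMap_eq_iff _ _).2 ?_).symm
  simpa using hm

/-- `a` is surjective when `G = HK`. [folklore] -/
theorem hkMap_surjective (hHK : ∀ g : G, ∃ h ∈ H, ∃ k ∈ K, g = h * k) :
    Surjective (hkMap H K) := by
  intro g
  obtain ⟨h, hh, k, hk, rfl⟩ := hHK g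
  exact ⟨(⟨h, hh⟩, ⟨k, hk⟩⁻¹), by simp [hkMap_apply]⟩

end Algebra

/-! ### Topology of `a`: open, proper, quotient; compactness of `M` -/

section Topology

variable {G : Type u} [Group G] [TopologicalSpace G] [IsTopologicalGroup G] {H K : Subgroup G}

/-- `hkMap` is continuous. [folklore] -/
theorem continuous_hkMap : Continuous (hkMap H K) :=
  (continuous_subtype_val.comp continuous_fst).mul (continuous_subtype_val.comp continuous_snd).inv

variable [LocallyCompactSpace G] [T2Space G] [SecondCountableTopology G]

/-- **`a` is open** (`isOpenMap_subgroup_mul` composed with `(h, k) ↦ (h, k⁻¹)`). [folklore] -/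
theorem isOpenMap_hkMap (hH : IsClosed (H : Set G)) (hK : IsCompact (K : Set G))
    (hHK : ∀ g : G, ∃ h ∈ H, ∃ k ∈ K, g = h * k) : IsOpenMap (hkMap H K) := by
  have h1 := isOpenMap_subgroup_mul hH hK hHK
  have h2 : IsOpenMap fun p : ↥H × ↥K => (p.1, p.2⁻¹) :=
    ((Homeomorph.refl ↥H).prodCongr (Homeomorph.inv ↥K)).isOpenMap
  have : hkMap H K = (fun p : ↥H × ↥K => (p.1 : G) * (p.2 : G)) ∘ fun p => (p.1, p.2⁻¹) := by
    funext p; simp [hkMap_apply]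
  rw [this]
  exact h1.comp h2

/-- `a` is a quotient map. [folklore] -/
theorem isQuotientMap_hkMap (hH : IsClosed (H : Set G)) (hK : IsCompact (K : Set G))
    (hHK : ∀ g : G, ∃ h ∈ H, ∃ k ∈ K, g = h * k) : IsQuotientMap (hkMap H K) :=
  (isOpenMap_hkMap hH hK hHK).isQuotientMap continuous_hkMap (hkMap_surjective hHK)

omit [LocallyCompactSpace G] [SecondCountableTopology G] in
/-- **`a` is proper**: preimages of compact sets are compact. [folklore] -/
theorem isCompact_preimage_hkMap (hH : IsClosed (H : Set G)) (hK : IsCompact (K : Set G))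
    {C : Set G} (hC : IsCompact C) : IsCompact (hkMap H K ⁻¹' C) := by
  have h1 := isCompact_preimage_subgroup_mul (H := H) hH hK hC
  set e : ↥H × ↥K ≃ₜ ↥H × ↥K := (Homeomorph.refl ↥H).prodCongr (Homeomorph.inv ↥K) with he
  have : hkMap H K ⁻¹' C = e ⁻¹' ((fun p : ↥H × ↥K => (p.1 : G) * (p.2 : G)) ⁻¹' C) := by
    ext p; simp [hkMap_apply, he]
  rw [this]
  exact e.isCompact_preimage.2 h1

omit [IsTopologicalGroup G] [LocallyCompactSpace G] [SecondCountableTopology G] in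
/-- The stabiliser `M` is compact (closed, and contained in `(H ∩ K) × K`). [folklore] -/
theorem isCompact_diagSubgroup (hH : IsClosed (H : Set G)) (hK : IsCompact (K : Set G)) :
    IsCompact (diagSubgroup H K : Set (↥H × ↥K)) := by
  haveI : CompactSpace ↥K := isCompact_iff_compactSpace.1 hK
  have hcl : IsClosed (diagSubgroup H K : Set (↥H × ↥K)) :=
    isClosed_eq (continuous_subtype_val.comp continuous_fst)
      (continuous_subtype_val.comp continuous_snd)
  have hA : IsCompact ((Subtype.val ⁻¹' (K : Set G) : Set ↥H) ×ˢ (univ : Set ↥K)) :=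
    (hH.isClosedEmbedding_subtypeVal.isCompact_preimage hK).prod isCompact_univ
  refine hA.of_isClosed_subset hcl ?_
  rintro ⟨h, k⟩ (hp : (h : G) = k)
  exact Set.mk_mem_prod (show (h : G) ∈ (K : Set G) by rw [hp]; exact k.2) (mem_univ _)

end Topology

/-! ### Fibre averages over `M` and descent along `a` -/

section Average

variable {G : Type u} [Group G] [TopologicalSpace G] [IsTopologicalGroup G] [LocallyCompactSpace G]
  [T2Space G] [SecondCountableTopology G] {H K : Subgroup G}
  (hH : IsClosed (H : Set G)) (hK : IsCompact (K : Set G))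

/-- The Borel σ-algebra on the stabiliser `M` (a local instance: integration over `M` is internal
to this file). [folklore] -/
@[reducible] def diagMeasurableSpace (H K : Subgroup G) : MeasurableSpace ↥(diagSubgroup H K) :=
  borel _

attribute [local instance] diagMeasurableSpace

omit [IsTopologicalGroup G] [LocallyCompactSpace G] [T2Space G] [SecondCountableTopology G] in
/-- `M` with `diagMeasurableSpace` is a Borel space (by definition). [folklore] -/
theorem borelSpace_diag (H K : Subgroup G) : BorelSpace ↥(diagSubgroup H K) := ⟨rfl⟩

attribute [local instance] borelSpace_diag

/-- The Haar probability measure of the compact stabiliser `M`. [folklore] -/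
def diagHaar : Measure ↥(diagSubgroup H K) :=
  haveI : CompactSpace ↥(diagSubgroup H K) :=
    isCompact_iff_compactSpace.1 (isCompact_diagSubgroup hH hK)
  Measure.haarMeasure (⊤ : TopologicalSpace.PositiveCompacts ↥(diagSubgroup H K))

/-- `diagHaar` is a Haar measure. [folklore] -/
instance isHaarMeasure_diagHaar : (diagHaar hH hK).IsHaarMeasure := by
  haveI : CompactSpace ↥(diagSubgroup H K) :=
    isCompact_iff_compactSpace.1 (isCompact_diagSubgroup hH hK)
  unfold diagHaar
  infer_instance

/-- `diagHaar` is a probability measure. [folklore] -/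
instance isProbabilityMeasure_diagHaar : IsProbabilityMeasure (diagHaar hH hK) := by
  haveI : CompactSpace ↥(diagSubgroup H K) :=
    isCompact_iff_compactSpace.1 (isCompact_diagSubgroup hH hK)
  refine ⟨?_⟩
  rw [← TopologicalSpace.PositiveCompacts.coe_top]
  exact Measure.haarMeasure_self

/-- The **fibre average** `∫_M φ(p m) dm` of `φ : H × K → ℝ`. [folklore] -/
def fibreAverage (φ : ↥H × ↥K → ℝ) (p : ↥H × ↥K) : ℝ :=
  ∫ m : ↥(diagSubgroup H K), φ (p * m) ∂diagHaar hH hK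

omit [LocallyCompactSpace G] [SecondCountableTopology G] in
/-- The fibre average is right `M`-invariant: `F(p m₀) = F(p)`. [folklore] -/
theorem fibreAverage_mul_of_mem (φ : ↥H × ↥K → ℝ) (p : ↥H × ↥K) {m₀ : ↥H × ↥K}
    (hm₀ : m₀ ∈ diagSubgroup H K) :
    fibreAverage hH hK φ (p * m₀) = fibreAverage hH hK φ p := by
  unfold fibreAverage
  have : (fun m : ↥(diagSubgroup H K) => φ (p * m₀ * m)) =
      fun m => (fun m' : ↥(diagSubgroup H K) => φ (p * m')) (⟨m₀, hm₀⟩ * m) := by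
    funext m; simp [mul_assoc]
  rw [this]
  exact integral_mul_left_eq_self (fun m' : ↥(diagSubgroup H K) => φ (p * m')) ⟨m₀, hm₀⟩

/-- The fibre average of a continuous function is continuous. [folklore] -/
theorem continuous_fibreAverage {φ : ↥H × ↥K → ℝ} (hφ : Continuous φ) :
    Continuous (fibreAverage hH hK φ) := by
  haveI : CompactSpace ↥(diagSubgroup H K) :=
    isCompact_iff_compactSpace.1 (isCompact_diagSubgroup hH hK)
  haveI : LocallyCompactSpace ↥H := hH.locallyCompactSpace
  haveI : CompactSpace ↥K := isCompact_iff_compactSpace.1 hK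
  haveI : SecondCountableTopology ↥H := TopologicalSpace.Subtype.secondCountableTopology (H : Set G)
  haveI : SecondCountableTopology ↥K := TopologicalSpace.Subtype.secondCountableTopology (K : Set G)
  have hc : Continuous (fun q : (↥H × ↥K) × ↥(diagSubgroup H K) => φ (q.1 * q.2)) :=
    hφ.comp (continuous_fst.mul (continuous_subtype_val.comp continuous_snd))
  have := continuous_parametric_integral_of_continuous (μ := diagHaar hH hK)
    (f := fun (x : ↥H × ↥K) (m : ↥(diagSubgroup H K)) => φ (x * m)) hc isCompact_univ
  show Continuous fun x : ↥H × ↥K => ∫ y : ↥(diagSubgroup H K), φ (x * y) ∂diagHaar hH hK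
  simpa only [Measure.restrict_univ] using this

/-- The fibre average of a compactly supported function is compactly supported (support in
`tsupport φ · M`). [folklore] -/
theorem hasCompactSupport_fibreAverage {φ : ↥H × ↥K → ℝ} (hφ : HasCompactSupport φ) :
    HasCompactSupport (fibreAverage hH hK φ) := by
  refine HasCompactSupport.intro (hφ.mul (isCompact_diagSubgroup hH hK)) fun p hp => ?_
  unfold fibreAverage
  refine integral_eq_zero_of_ae (Eventually.of_forall fun m => ?_)
  show φ (p * m) = 0
  by_contra hne
  exact hp ⟨p * m, subset_tsupport _ hne, ((m : ↥H × ↥K))⁻¹, (diagSubgroup H K).inv_mem m.2,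
    by simp⟩

omit [LocallyCompactSpace G] [SecondCountableTopology G] in
/-- The fibre average is additive (for continuous compactly supported functions). [folklore] -/
theorem fibreAverage_add {φ ψ : ↥H × ↥K → ℝ} (hφ : Continuous φ) (hψ : Continuous ψ)
    (p : ↥H × ↥K) :
    fibreAverage hH hK (φ + ψ) p = fibreAverage hH hK φ p + fibreAverage hH hK ψ p := by
  haveI : CompactSpace ↥(diagSubgroup H K) :=
    isCompact_iff_compactSpace.1 (isCompact_diagSubgroup hH hK)
  unfold fibreAverage
  simp only [Pi.add_apply]
  refine integral_add ?_ ?_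
  · exact (hφ.comp (continuous_const.mul continuous_subtype_val)).integrable_of_hasCompactSupport
      (HasCompactSupport.of_compactSpace _)
  · exact (hψ.comp (continuous_const.mul continuous_subtype_val)).integrable_of_hasCompactSupport
      (HasCompactSupport.of_compactSpace _)

omit [LocallyCompactSpace G] [SecondCountableTopology G] in
/-- The fibre average is homogeneous. [folklore] -/
theorem fibreAverage_smul (c : ℝ) (φ : ↥H × ↥K → ℝ) (p : ↥H × ↥K) :
    fibreAverage hH hK (c • φ) p = c * fibreAverage hH hK φ p := by
  unfold fibreAverage
  simp only [Pi.smul_apply, smul_eq_mul, integral_const_mul]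

omit [LocallyCompactSpace G] [SecondCountableTopology G] in
/-- The fibre average of a non-negative function is non-negative. [folklore] -/
theorem fibreAverage_nonneg {φ : ↥H × ↥K → ℝ} (hφ : 0 ≤ φ) (p : ↥H × ↥K) :
    0 ≤ fibreAverage hH hK φ p :=
  integral_nonneg fun _ => hφ _

omit [LocallyCompactSpace G] [SecondCountableTopology G] in
/-- The fibre average of a constant-on-fibres function `f ∘ a` is `f ∘ a`. [folklore] -/
theorem fibreAverage_comp_hkMap (f : G → ℝ) (p : ↥H × ↥K) :
    fibreAverage hH hK (f ∘ hkMap H K) p = f (hkMap H K p) := by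
  unfold fibreAverage
  have : (fun m : ↥(diagSubgroup H K) => (f ∘ hkMap H K) (p * m)) = fun _ => f (hkMap H K p) := by
    funext m
    simp only [Function.comp_apply, hkMap_mul_of_mem p m.2]
  rw [this, integral_const, smul_eq_mul, measureReal_def, measure_univ, ENNReal.toReal_one, one_mul]

variable (hHK : ∀ g : G, ∃ h ∈ H, ∃ k ∈ K, g = h * k)

/-- **Descent along `a`**: `descend φ (g) = F_φ(p)` for any `p` with `a(p) = g` (a section of the
surjection `a`; independent of the choice by right `M`-invariance of the fibre average). [folklore] -/
def descend (φ : ↥H × ↥K → ℝ) (g : G) : ℝ :=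
  fibreAverage hH hK φ (surjInv (hkMap_surjective hHK) g)

omit [LocallyCompactSpace G] [SecondCountableTopology G] in
/-- **`descend φ ∘ a = F_φ`.** [folklore] -/
theorem descend_hkMap (φ : ↥H × ↥K → ℝ) (p : ↥H × ↥K) :
    descend hH hK hHK φ (hkMap H K p) = fibreAverage hH hK φ p := by
  unfold descend
  set q := surjInv (hkMap_surjective hHK) (hkMap H K p) with hq
  have hqa : hkMap H K q = hkMap H K p := surjInv_eq (hkMap_surjective hHK) _
  have hm : p⁻¹ * q ∈ diagSubgroup H K := (hkMap_eq_iff p q).1 hqa.symm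
  have : q = p * (p⁻¹ * q) := by rw [mul_inv_cancel_left]
  rw [this, fibreAverage_mul_of_mem hH hK φ p hm]

/-- `descend φ` is continuous for continuous `φ` (`a` is a quotient map and
`descend φ ∘ a = F_φ` is continuous). [folklore] -/
theorem continuous_descend {φ : ↥H × ↥K → ℝ} (hφ : Continuous φ) :
    Continuous (descend hH hK hHK φ) := by
  rw [(isQuotientMap_hkMap hH hK hHK).continuous_iff]
  have : descend hH hK hHK φ ∘ hkMap H K = fibreAverage hH hK φ :=
    funext fun p => descend_hkMap hH hK hHK φ p
  rw [this]
  exact continuous_fibreAverage hH hK hφ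

/-- `descend φ` is compactly supported for compactly supported `φ` (support in the image under `a`
of the support of `F_φ`). [folklore] -/
theorem hasCompactSupport_descend {φ : ↥H × ↥K → ℝ} (hφs : HasCompactSupport φ) :
    HasCompactSupport (descend hH hK hHK φ) := by
  have hF := hasCompactSupport_fibreAverage hH hK hφs
  refine HasCompactSupport.intro (hF.image continuous_hkMap) fun g hg => ?_
  unfold descend
  by_contra hne
  apply hg
  refine ⟨surjInv (hkMap_surjective hHK) g, subset_tsupport _ hne, ?_⟩
  exact surjInv_eq (hkMap_surjective hHK) g

omit [LocallyCompactSpace G] [SecondCountableTopology G] in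
/-- `descend` is additive on continuous compactly supported functions. [folklore] -/
theorem descend_add {φ ψ : ↥H × ↥K → ℝ} (hφ : Continuous φ) (hψ : Continuous ψ) (g : G) :
    descend hH hK hHK (φ + ψ) g = descend hH hK hHK φ g + descend hH hK hHK ψ g := by
  unfold descend
  exact fibreAverage_add hH hK hφ hψ _

omit [LocallyCompactSpace G] [SecondCountableTopology G] in
/-- `descend` is homogeneous. [folklore] -/
theorem descend_smul (c : ℝ) (φ : ↥H × ↥K → ℝ) (g : G) :
    descend hH hK hHK (c • φ) g = c * descend hH hK hHK φ g := by
  unfold descend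
  exact fibreAverage_smul hH hK c φ _

omit [LocallyCompactSpace G] [SecondCountableTopology G] in
/-- `descend` preserves non-negativity. [folklore] -/
theorem descend_nonneg {φ : ↥H × ↥K → ℝ} (hφ : 0 ≤ φ) (g : G) : 0 ≤ descend hH hK hHK φ g :=
  fibreAverage_nonneg hH hK hφ _

omit [LocallyCompactSpace G] [SecondCountableTopology G] in
/-- **`descend (f ∘ a) = f`**: functions pulled back from `G` descend to themselves. [folklore] -/
theorem descend_comp_hkMap (f : G → ℝ) (g : G) : descend hH hK hHK (f ∘ hkMap H K) g = f g := by
  unfold descend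
  rw [fibreAverage_comp_hkMap, surjInv_eq (hkMap_surjective hHK) g]

omit [LocallyCompactSpace G] [SecondCountableTopology G] in
/-- **Left translations upstairs are `g ↦ h₀ g k₀⁻¹` downstairs**:
`descend (φ(p₀⁻¹ ·)) (g) = descend φ (h₀⁻¹ g k₀)` for `p₀ = (h₀, k₀)`. [folklore] -/
theorem descend_comp_mul_left (φ : ↥H × ↥K → ℝ) (p₀ : ↥H × ↥K) (g : G) :
    descend hH hK hHK (fun p => φ (p₀ * p)) g =
      descend hH hK hHK φ ((p₀.1 : G) * g * ((p₀.2 : G))⁻¹) := by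
  -- write `g = a(q)`
  obtain ⟨q, rfl⟩ := hkMap_surjective hHK g
  rw [descend_hkMap, ← hkMap_mul, descend_hkMap]
  unfold fibreAverage
  simp only [mul_assoc]

end Average

/-! ### The invariant functional on `C_c(H × K)` and its Riesz measure -/

section Functional

variable {G : Type u} [Group G] [TopologicalSpace G] [IsTopologicalGroup G] [LocallyCompactSpace G]
  [T2Space G] [SecondCountableTopology G] [MeasurableSpace G] [BorelSpace G] {H K : Subgroup G}
  (hH : IsClosed (H : Set G)) (hK : IsCompact (K : Set G))
  (hHK : ∀ g : G, ∃ h ∈ H, ∃ k ∈ K, g = h * k) (μG : Measure G) [IsHaarMeasure μG]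

/-- `descend` of a `C_c` function, as a `C_c` function on `G`. [folklore] -/
def descendCc (φ : C_c(↥H × ↥K, ℝ)) : C_c(G, ℝ) where
  toFun := descend hH hK hHK φ
  continuous_toFun := continuous_descend hH hK hHK φ.continuous
  hasCompactSupport' := hasCompactSupport_descend hH hK hHK φ.hasCompactSupport

omit [MeasurableSpace G] [BorelSpace G] in
/-- `descendCc φ g = descend φ g` (definitional). [folklore] -/
@[simp]
theorem descendCc_apply (φ : C_c(↥H × ↥K, ℝ)) (g : G) :
    descendCc hH hK hHK φ g = descend hH hK hHK φ g := rfl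

/-- **The functional `Λ(φ) = ∫_G descend φ dμ_G`** on `C_c(H × K)`: linear and positive.
[folklore] -/
def fibreFunctional : C_c(↥H × ↥K, ℝ) →ₚ[ℝ] ℝ :=
  PositiveLinearMap.mk₀
    { toFun := fun φ => ∫ g, descendCc hH hK hHK φ g ∂μG
      map_add' := fun φ ψ => by
        have hφi := (descendCc hH hK hHK φ).integrable (μ := μG)
        have hψi := (descendCc hH hK hHK ψ).integrable (μ := μG)
        rw [← integral_add hφi hψi]
        refine integral_congr_ae (Eventually.of_forall fun g => ?_)
        simp only [descendCc_apply, CompactlySupportedContinuousMap.coe_add]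
        exact descend_add hH hK hHK φ.continuous ψ.continuous g
      map_smul' := fun c φ => by
        simp only [RingHom.id_apply, smul_eq_mul, ← integral_const_mul]
        refine integral_congr_ae (Eventually.of_forall fun g => ?_)
        simp only [descendCc_apply, CompactlySupportedContinuousMap.coe_smul]
        exact descend_smul hH hK hHK c φ g }
    fun φ hφ => integral_nonneg fun g => descend_nonneg hH hK hHK (fun p => hφ p) g

/-- `Λ φ = ∫_G descend φ dμ_G` (definitional). [folklore] -/
theorem fibreFunctional_apply (φ : C_c(↥H × ↥K, ℝ)) :
    fibreFunctional hH hK hHK μG φ = ∫ g, descend hH hK hHK φ g ∂μG := rfl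

include hK in
/-- **`Δ_G ≡ 1` on a compact subgroup**: right translation by `k ∈ K` preserves the left Haar
measure `μ_G`. The compact set `A = C K` (`C` a compact neighbourhood of `1`) is right
`K`-invariant and `μ_G(A k⁻¹) = Δ(k) μ_G(A)` with `0 < μ_G(A) < ∞`. [folklore] -/
theorem map_mul_right_eq_self_of_mem_compact {k : G} (hk : k ∈ K) :
    Measure.map (· * k) μG = μG := by
  -- `Δ(k) = 1`
  obtain ⟨C, hCc, hC1⟩ := exists_compact_mem_nhds (1 : G)
  set A : Set G := C * (K : Set G) with hA
  have hAc : IsCompact A := hCc.mul hK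
  have hAk : (fun x => x * k) ⁻¹' A = A := by
    ext x
    constructor
    · rintro ⟨c, hc, k', hk', h⟩
      refine ⟨c, hc, k' * k⁻¹, K.mul_mem hk' (K.inv_mem hk), ?_⟩
      show c * (k' * k⁻¹) = x
      have h' : c * k' = x * k := h
      rw [← mul_assoc, h', mul_inv_cancel_right]
    · rintro ⟨c, hc, k', hk', rfl⟩
      refine ⟨c, hc, k' * k, K.mul_mem hk' hk, ?_⟩
      show c * (k' * k) = c * k' * k
      rw [mul_assoc]
  have hA0 : μG A ≠ 0 := by
    have h1A : (interior C) ⊆ A := interior_subset.trans fun c hc => ⟨c, hc, 1, K.one_mem, mul_one c⟩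
    exact ((isOpen_interior.measure_pos μG ⟨1, mem_interior_iff_mem_nhds.2 hC1⟩).trans_le
      (measure_mono h1A)).ne'
  have hAtop : μG A ≠ ∞ := hAc.measure_lt_top.ne
  have hmap : Measure.map (· * k) μG = modularCharacterFun k • μG :=
    map_right_mul_eq_modularCharacterFun_smul μG k
  have hval : μG A = modularCharacterFun k • μG A := by
    have := congrArg (fun ν : Measure G => ν A) hmap
    simp only [Measure.smul_apply] at this
    rwa [map_apply (measurable_mul_const k) hAc.measurableSet, hAk] at this
  have hone : modularCharacterFun k = 1 := by
    have h2 : (1 : ℝ≥0∞) * μG A = (modularCharacterFun k : ℝ≥0∞) * μG A := by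
      rw [one_mul]; exact_mod_cast hval
    have := (ENNReal.mul_left_inj hA0 hAtop).1 h2
    exact_mod_cast this.symm
  rw [hmap, hone, one_smul]

/-- **Invariance of `Λ` under left translations of `H × K`.** For `p₀ = (h₀, k₀)`:
`Λ(φ(p₀ ·)) = ∫ descend φ (h₀ g k₀⁻¹) dμ_G = Λ(φ)` (left invariance of `μ_G` and `Δ_G(k₀) = 1`).
[folklore] -/
theorem fibreFunctional_comp_mul_left (φ : C_c(↥H × ↥K, ℝ)) (p₀ : ↥H × ↥K)
    (φ' : C_c(↥H × ↥K, ℝ)) (hφ' : ∀ p, φ' p = φ (p₀ * p)) :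
    fibreFunctional hH hK hHK μG φ' = fibreFunctional hH hK hHK μG φ := by
  rw [fibreFunctional_apply, fibreFunctional_apply]
  have hfun : (φ' : ↥H × ↥K → ℝ) = fun p => φ (p₀ * p) := funext hφ'
  rw [hfun]
  simp_rw [descend_comp_mul_left hH hK hHK φ p₀]
  -- `∫ F(h₀ g k₀⁻¹) dμ_G = ∫ F dμ_G`
  set F : G → ℝ := descend hH hK hHK φ with hF
  have h1 : ∫ g, F ((p₀.1 : G) * g * ((p₀.2 : G))⁻¹) ∂μG =
      ∫ g, F (g * ((p₀.2 : G))⁻¹) ∂μG :=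
    integral_mul_left_eq_self (fun g => F (g * ((p₀.2 : G))⁻¹)) (p₀.1 : G)
  rw [h1]
  have hk : ((p₀.2 : G))⁻¹ ∈ K := K.inv_mem p₀.2.2
  have h2 := map_mul_right_eq_self_of_mem_compact hK μG hk
  calc ∫ g, F (g * ((p₀.2 : G))⁻¹) ∂μG = ∫ g, F g ∂(Measure.map (· * ((p₀.2 : G))⁻¹) μG) := by
        rw [integral_map (measurable_mul_const _).aemeasurable]
        exact (continuous_descend hH hK hHK φ.continuous).aestronglyMeasurable
    _ = ∫ g, F g ∂μG := by rw [h2]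

/-- The **Riesz measure `λ̃` of `Λ`** on `H × K`. [folklore] -/
def fibreMeasure : Measure (↥H × ↥K) :=
  haveI : LocallyCompactSpace ↥H := hH.locallyCompactSpace
  haveI : CompactSpace ↥K := isCompact_iff_compactSpace.1 hK
  haveI : SecondCountableTopology ↥H := TopologicalSpace.Subtype.secondCountableTopology (H : Set G)
  haveI : SecondCountableTopology ↥K := TopologicalSpace.Subtype.secondCountableTopology (K : Set G)
  RealRMK.rieszMeasure (fibreFunctional hH hK hHK μG)

/-- `∫ φ dλ̃ = Λ φ` for `φ ∈ C_c(H × K)` (Riesz–Markov–Kakutani). [folklore] -/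
theorem integral_fibreMeasure (φ : C_c(↥H × ↥K, ℝ)) :
    ∫ p, φ p ∂fibreMeasure hH hK hHK μG = ∫ g, descend hH hK hHK φ g ∂μG := by
  haveI : LocallyCompactSpace ↥H := hH.locallyCompactSpace
  haveI : CompactSpace ↥K := isCompact_iff_compactSpace.1 hK
  haveI : SecondCountableTopology ↥H := TopologicalSpace.Subtype.secondCountableTopology (H : Set G)
  haveI : SecondCountableTopology ↥K := TopologicalSpace.Subtype.secondCountableTopology (K : Set G)
  unfold fibreMeasure
  rw [RealRMK.integral_rieszMeasure]
  rfl

/-- `λ̃` is regular. [folklore] -/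
instance regular_fibreMeasure : (fibreMeasure hH hK hHK μG).Regular := by
  haveI : LocallyCompactSpace ↥H := hH.locallyCompactSpace
  haveI : CompactSpace ↥K := isCompact_iff_compactSpace.1 hK
  haveI : SecondCountableTopology ↥H := TopologicalSpace.Subtype.secondCountableTopology (H : Set G)
  haveI : SecondCountableTopology ↥K := TopologicalSpace.Subtype.secondCountableTopology (K : Set G)
  unfold fibreMeasure
  infer_instance

/-- **`λ̃` is left invariant** (invariance of `Λ`, transported through the Riesz representation and
the uniqueness of the representing regular measure). [folklore] -/
theorem isMulLeftInvariant_fibreMeasure : (fibreMeasure hH hK hHK μG).IsMulLeftInvariant := by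
  haveI : LocallyCompactSpace ↥H := hH.locallyCompactSpace
  haveI : CompactSpace ↥K := isCompact_iff_compactSpace.1 hK
  haveI : SecondCountableTopology ↥H := TopologicalSpace.Subtype.secondCountableTopology (H : Set G)
  haveI : SecondCountableTopology ↥K := TopologicalSpace.Subtype.secondCountableTopology (K : Set G)
  refine ⟨fun p₀ => ?_⟩
  haveI : (Measure.map (p₀ * ·) (fibreMeasure hH hK hHK μG)).Regular :=
    Regular.map (Homeomorph.mulLeft p₀)
  refine Measure.ext_of_integral_eq_on_compactlySupported fun φ => ?_
  rw [show (∫ x, φ x ∂Measure.map (fun x => p₀ * x) (fibreMeasure hH hK hHK μG)) =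
      ∫ x, φ (p₀ * x) ∂fibreMeasure hH hK hHK μG from
    integral_map (measurable_const_mul p₀).aemeasurable φ.continuous.aestronglyMeasurable]
  -- the translate of `φ` as a `C_c` function
  set φ' : C_c(↥H × ↥K, ℝ) := ⟨⟨fun p => φ (p₀ * p), φ.continuous.comp (continuous_const_mul p₀)⟩,
    φ.hasCompactSupport.comp_homeomorph (Homeomorph.mulLeft p₀)⟩ with hφ'
  have h1 : ∫ p, φ (p₀ * p) ∂fibreMeasure hH hK hHK μG = ∫ p, φ' p ∂fibreMeasure hH hK hHK μG := rfl
  rw [h1, integral_fibreMeasure, integral_fibreMeasure,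
    ← fibreFunctional_apply hH hK hHK μG, ← fibreFunctional_apply hH hK hHK μG]
  exact fibreFunctional_comp_mul_left hH hK hHK μG φ p₀ φ' fun p => rfl

end Functional

/-! ### Assembly: the formula for `C_c(G)`, the measure identity, and `L¹(G)` -/

section Assembly

variable {G : Type u} [Group G] [TopologicalSpace G] [IsTopologicalGroup G] [LocallyCompactSpace G]
  [T2Space G] [SecondCountableTopology G] [MeasurableSpace G] [BorelSpace G] {H K : Subgroup G}
  (hH : IsClosed (H : Set G)) (hK : IsCompact (K : Set G))
  (hHK : ∀ g : G, ∃ h ∈ H, ∃ k ∈ K, g = h * k) (μG : Measure G) [IsHaarMeasure μG]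
  (μH : Measure ↥H) (μK : Measure ↥K) [IsHaarMeasure μH] [IsHaarMeasure μK]

/-- Pull-back of `f ∈ C_c(G)` along the proper map `a`, as an element of `C_c(H × K)`. [folklore] -/
def pullbackCc (f : C_c(G, ℝ)) : C_c(↥H × ↥K, ℝ) where
  toFun := f ∘ hkMap H K
  continuous_toFun := f.continuous.comp continuous_hkMap
  hasCompactSupport' :=
    HasCompactSupport.intro (isCompact_preimage_hkMap hH hK f.hasCompactSupport) fun _ hp =>
      image_eq_zero_of_notMem_tsupport (f := ⇑f) hp

omit [MeasurableSpace G] [BorelSpace G] in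
/-- `pullbackCc f p = f (a p)` (definitional). [folklore] -/
@[simp]
theorem pullbackCc_apply (f : C_c(G, ℝ)) (p : ↥H × ↥K) : pullbackCc hH hK f p = f (hkMap H K p) := rfl

/-- The constant `c = haarScalarFactor λ̃ (μ_H ⊗ μ_K)`. [folklore] -/
def decompConst : NNReal :=
  haveI : LocallyCompactSpace ↥H := hH.locallyCompactSpace
  haveI : CompactSpace ↥K := isCompact_iff_compactSpace.1 hK
  haveI : SecondCountableTopology ↥H := TopologicalSpace.Subtype.secondCountableTopology (H : Set G)
  haveI : SecondCountableTopology ↥K := TopologicalSpace.Subtype.secondCountableTopology (K : Set G)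
  haveI := isMulLeftInvariant_fibreMeasure hH hK hHK μG
  haarScalarFactor (fibreMeasure hH hK hHK μG) (μH.prod μK)

/-- **`λ̃ = c · (μ_H ⊗ μ_K)`** (uniqueness of left Haar measure on `H × K`). [folklore] -/
theorem fibreMeasure_eq_smul_prod :
    fibreMeasure hH hK hHK μG = decompConst hH hK hHK μG μH μK • μH.prod μK := by
  haveI : LocallyCompactSpace ↥H := hH.locallyCompactSpace
  haveI : CompactSpace ↥K := isCompact_iff_compactSpace.1 hK
  haveI : SecondCountableTopology ↥H := TopologicalSpace.Subtype.secondCountableTopology (H : Set G)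
  haveI : SecondCountableTopology ↥K := TopologicalSpace.Subtype.secondCountableTopology (K : Set G)
  haveI := isMulLeftInvariant_fibreMeasure hH hK hHK μG
  exact isMulLeftInvariant_eq_smul_of_regular (fibreMeasure hH hK hHK μG) (μH.prod μK)

/-- **The formula for `f ∈ C_c(G)`, product form**:
`∫_G f dμ_G = c ∫_{H × K} f(h k⁻¹) d(μ_H ⊗ μ_K)`. [folklore] -/
theorem integral_eq_mul_integral_prod_of_compactlySupported (f : C_c(G, ℝ)) :
    ∫ g, f g ∂μG = (decompConst hH hK hHK μG μH μK : ℝ) *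
      ∫ p, f (hkMap H K p) ∂(μH.prod μK) := by
  have h1 : ∫ g, f g ∂μG = ∫ g, descend hH hK hHK (pullbackCc hH hK f) g ∂μG := by
    refine integral_congr_ae (Eventually.of_forall fun g => ?_)
    show f g = descend hH hK hHK (f ∘ hkMap H K) g
    rw [descend_comp_hkMap]
  rw [h1, ← integral_fibreMeasure hH hK hHK μG (pullbackCc hH hK f),
    fibreMeasure_eq_smul_prod hH hK hHK μG μH μK, integral_smul_nnreal_measure]
  rfl

/-- **The formula for `f ∈ C_c(G)`**: `∫_G f dμ_G = c ∫_H ∫_K f(hk) dμ_K dμ_H` (Tonelli on `H × K`,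
then inversion invariance of the Haar measure of the compact group `K`). [folklore] -/
theorem integral_eq_mul_integral_integral_of_compactlySupported (f : C_c(G, ℝ)) :
    ∫ g, f g ∂μG = (decompConst hH hK hHK μG μH μK : ℝ) *
      ∫ h, ∫ k, f ((h : G) * (k : G)) ∂μK ∂μH := by
  haveI : LocallyCompactSpace ↥H := hH.locallyCompactSpace
  haveI : CompactSpace ↥K := isCompact_iff_compactSpace.1 hK
  haveI : SecondCountableTopology ↥H := TopologicalSpace.Subtype.secondCountableTopology (H : Set G)
  haveI : SecondCountableTopology ↥K := TopologicalSpace.Subtype.secondCountableTopology (K : Set G)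
  haveI := isInvInvariant_of_compactSpace μK
  rw [integral_eq_mul_integral_prod_of_compactlySupported hH hK hHK μG μH μK f]
  congr 1
  have hint : Integrable (fun p : ↥H × ↥K => f (hkMap H K p)) (μH.prod μK) :=
    (pullbackCc hH hK f).integrable
  rw [integral_prod _ hint]
  refine integral_congr_ae (Eventually.of_forall fun h => ?_)
  show ∫ k, f (hkMap H K (h, k)) ∂μK = ∫ k, f ((h : G) * (k : G)) ∂μK
  have : (fun k : ↥K => f (hkMap H K (h, k))) = fun k => (fun k' : ↥K => f ((h : G) * (k' : G))) k⁻¹ := by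
    funext k; simp [hkMap_apply]
  rw [this, integral_inv_eq_self (fun k' : ↥K => f ((h : G) * (k' : G))) μK]

/-- **The constant is positive** (test against a non-negative bump with positive integral). [folklore] -/
theorem decompConst_pos : 0 < decompConst hH hK hHK μG μH μK := by
  obtain ⟨⟨f, hfc⟩, hfs, hf0, hf1⟩ : ∃ f : C(G, ℝ), HasCompactSupport f ∧ 0 ≤ f ∧ f 1 ≠ 0 :=
    exists_continuous_nonneg_pos 1
  have hpos : 0 < ∫ g, f g ∂μG := hfc.integral_pos_of_hasCompactSupport_nonneg_nonzero hfs hf0 hf1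
  have h := integral_eq_mul_integral_prod_of_compactlySupported hH hK hHK μG μH μK ⟨⟨f, hfc⟩, hfs⟩
  by_contra hc
  have hc0 : decompConst hH hK hHK μG μH μK = 0 := le_antisymm (not_lt.1 hc) bot_le
  rw [hc0] at h
  simp only [NNReal.coe_zero, zero_mul] at h
  exact hpos.ne' h

/-- **The measure identity `μ_G = c · a_*(μ_H ⊗ μ_K)`** (both sides regular; they agree on `C_c(G)`).
[folklore] -/
theorem eq_smul_map_prod :
    μG = (decompConst hH hK hHK μG μH μK : ℝ≥0∞) • Measure.map (hkMap H K) (μH.prod μK) := by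
  haveI : LocallyCompactSpace ↥H := hH.locallyCompactSpace
  haveI : CompactSpace ↥K := isCompact_iff_compactSpace.1 hK
  haveI : SecondCountableTopology ↥H := TopologicalSpace.Subtype.secondCountableTopology (H : Set G)
  haveI : SecondCountableTopology ↥K := TopologicalSpace.Subtype.secondCountableTopology (K : Set G)
  set ρ : Measure G := Measure.map (hkMap H K) (μH.prod μK) with hρ
  have hmeas : Measurable (hkMap H K) := continuous_hkMap.measurable
  haveI : IsFiniteMeasureOnCompacts ρ := ⟨fun C hC => by
    rw [hρ, map_apply hmeas hC.measurableSet]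
    exact (isCompact_preimage_hkMap hH hK hC).measure_lt_top⟩
  haveI : (((decompConst hH hK hHK μG μH μK : ℝ≥0∞)) • ρ).Regular := Regular.smul (by simp)
  refine Measure.ext_of_integral_eq_on_compactlySupported fun f => ?_
  rw [integral_eq_mul_integral_prod_of_compactlySupported hH hK hHK μG μH μK f,
    integral_smul_measure, hρ,
    show (∫ x, f x ∂Measure.map (hkMap H K) (μH.prod μK)) = ∫ p, f (hkMap H K p) ∂(μH.prod μK) from
      integral_map hmeas.aemeasurable f.continuous.aestronglyMeasurable,
    ENNReal.coe_toReal]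
  rfl

/-- **The formula for integrable `f` (Banach-space valued)**:
`∫_G f dμ_G = c ∫_H ∫_K f(hk) dμ_K dμ_H` for every `f ∈ L¹(G, μ_G)` (from the measure identity
`μ_G = c · a_*(μ_H ⊗ μ_K)`, Fubini on `H × K` and inversion invariance of `μ_K`). [folklore] -/
theorem integral_eq_smul_integral_integral {E : Type*} [NormedAddCommGroup E] [NormedSpace ℝ E]
    (f : G → E) (hf : Integrable f μG) :
    ∫ g, f g ∂μG = (decompConst hH hK hHK μG μH μK : ℝ) •
      ∫ h, ∫ k, f ((h : G) * (k : G)) ∂μK ∂μH := by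
  haveI : LocallyCompactSpace ↥H := hH.locallyCompactSpace
  haveI : CompactSpace ↥K := isCompact_iff_compactSpace.1 hK
  haveI : SecondCountableTopology ↥H := TopologicalSpace.Subtype.secondCountableTopology (H : Set G)
  haveI : SecondCountableTopology ↥K := TopologicalSpace.Subtype.secondCountableTopology (K : Set G)
  haveI := isInvInvariant_of_compactSpace μK
  set c : ℝ≥0∞ := (decompConst hH hK hHK μG μH μK : ℝ≥0∞) with hc
  set ρ : Measure G := Measure.map (hkMap H K) (μH.prod μK) with hρ
  have hmeas : Measurable (hkMap H K) := continuous_hkMap.measurable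
  have hμ : μG = c • ρ := eq_smul_map_prod hH hK hHK μG μH μK
  have hc0 : c ≠ 0 := by
    rw [hc, ne_eq, ENNReal.coe_eq_zero]
    exact (decompConst_pos hH hK hHK μG μH μK).ne'
  have hctop : c ≠ ∞ := ENNReal.coe_ne_top
  -- integrability with respect to `ρ` and to the product measure
  have hfρ : Integrable f ρ := by
    have h1 : Integrable f (c • ρ) := by rw [← hμ]; exact hf
    exact (integrable_smul_measure hc0 hctop).1 h1
  have hfm : AEStronglyMeasurable f (Measure.map (hkMap H K) (μH.prod μK)) := hfρ.1
  have hint : Integrable (fun p : ↥H × ↥K => f (hkMap H K p)) (μH.prod μK) :=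
    (integrable_map_measure hfm hmeas.aemeasurable).1 hfρ
  calc ∫ g, f g ∂μG = ∫ g, f g ∂(c • ρ) := by rw [← hμ]
    _ = c.toReal • ∫ g, f g ∂ρ := integral_smul_measure f c
    _ = c.toReal • ∫ p, f (hkMap H K p) ∂(μH.prod μK) := by
        rw [hρ, integral_map hmeas.aemeasurable hfm]
    _ = c.toReal • ∫ h, ∫ k, f (hkMap H K (h, k)) ∂μK ∂μH := by rw [integral_prod _ hint]
    _ = (decompConst hH hK hHK μG μH μK : ℝ) • ∫ h, ∫ k, f ((h : G) * (k : G)) ∂μK ∂μH := by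
        rw [hc, ENNReal.coe_toReal]
        congr 1
        refine integral_congr_ae (Eventually.of_forall fun h => ?_)
        show ∫ k, f (hkMap H K (h, k)) ∂μK = ∫ k, f ((h : G) * (k : G)) ∂μK
        have : (fun k : ↥K => f (hkMap H K (h, k))) =
            fun k => (fun k' : ↥K => f ((h : G) * (k' : G))) k⁻¹ := by
          funext k; simp [hkMap_apply]
        rw [this, integral_inv_eq_self (fun k' : ↥K => f ((h : G) * (k' : G))) μK]

end Assembly

/-! ### The printed statement, for second countable `G` -/

/-- **Deitmar–Echterhoff, Prop. 1.5.6, proved for second countable `G`.** For a locally compact second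
countable Hausdorff group `G`, a closed subgroup `H` and a compact subgroup `K` with `G = HK`, and
left Haar measures `μ_G, μ_H, μ_K`, there is `c > 0` with
`∫_G f dμ_G = c ∫_H ∫_K f(hk) dμ_K(k) dμ_H(h)` for every `f ∈ L¹(G)` — the conclusion of the named
fact `DeitmarEchterhoff2014_prop156` (`HaarIntegralClosedCompact`), which is stated (as printed) for
arbitrary locally compact groups; the second countable case proved here covers the groups of the
tree's applications (`GL_n(F)`, `GL_n(𝔸_K)` and their subgroups).
[cite: DeitmarEchterhoff2014, Prop. 1.5.6] -/
theorem integral_eq_mul_integral_integral_of_secondCountable (G : Type u) [Group G]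
    [TopologicalSpace G] [IsTopologicalGroup G] [LocallyCompactSpace G] [T2Space G]
    [SecondCountableTopology G] [MeasurableSpace G] [BorelSpace G] (H K : Subgroup G)
    (hH : IsClosed (H : Set G)) (hK : IsCompact (K : Set G))
    (hHK : ∀ g : G, ∃ h ∈ H, ∃ k ∈ K, g = h * k) (μG : Measure G) [IsHaarMeasure μG]
    (μH : Measure ↥H) [IsHaarMeasure μH] (μK : Measure ↥K) [IsHaarMeasure μK] :
    ∃ c : ℝ, 0 < c ∧ ∀ f : G → ℂ, Integrable f μG →
      ∫ g, f g ∂μG = c * ∫ h, ∫ k, f ((h : G) * (k : G)) ∂μK ∂μH := by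
  refine ⟨decompConst hH hK hHK μG μH μK, ?_, fun f hf => ?_⟩
  · exact_mod_cast decompConst_pos hH hK hHK μG μH μK
  · rw [integral_eq_smul_integral_integral hH hK hHK μG μH μK f hf, Complex.real_smul]



end HaarHK

end Literature.NumberTheory.Automorphic
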